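import Summits.Ventures.CertifiedArithmetic.Expansions.CompressTopErrorPow2
import Summits.Ventures.CertifiedArithmetic.Expansions.CompressTopError

/-!
# COMPRESS never overshoots a power of two (new work)

New work of the certified-arithmetic venture (ENGINES group: shared numerical engines serving
client cells; rigour lives in the verifiers; every published number belongs to a client cell's
ledger, not to the engines group), continuing `Expansions/CompressTopError.lean` and
`Expansions/CompressTopErrorPow2.lean`.

THE THEOREM (`abs_compress_top_lt_two_zpow`, ANY round-to-nearest, `p ≥ 2`, `e` a nonoverlapping
expansion of floats, `b ≥ emin + p`):
`|Σ e| < 2^b − 2^(b−1)/(2^p − 1)  ⟹  |L| < 2^b` for the largest component `L` of `compress fl e`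
(`abs_compress_getLast_lt_two_zpow` is the same in `getLast?` form).  So rounding inside COMPRESS
can carry the top component ONTO a power of two only from within the margin
`2^(b−1)/(2^p − 1) = ulp(2^b⁻)/2 · (1 + ε + ε² + ⋯)`, `ε = 2^-p`, never from further inside, and
never BEYOND it.

PROOF.  `Σ e = L + Σ t` (`t` = the lower components).  If `|L| = 2^b` and `Σ t` points towards
zero, the power-of-two sharpening `compress_top_error_pow2` gives
`|Σ t| ≤ ulp(L)/4 · (1 + ⋯ + ε^(k−1)) < 2^(b−1)/(2^p − 1)`, contradicting the hypothesis; if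
`Σ t` points away, `|Σ e| ≥ 2^b`.  If `|L| > 2^b` then `|L| ≥ 2^b + 2^(b−p+1)` (the next float)
while `|Σ t| < |L|/(2^p − 1)` by `compress_top_error`, and `|Σ e| ≥ |L|(2^p − 2)/(2^p − 1)`
exceeds the threshold (this uses `p ≥ 2`).

WHY THE MARGIN (numerical, seat folder `desk/topP.py`, `desk/topplan.py`; exact rational model of
COMPRESS with every tie broken both ways): the ratio `|Σe − L| / (ulp(Σe)/2)` attains
`1 + ε + ⋯ + ε^(k−1)` for every number `k` of lower components (`p = 2, 3`; 0 violations of the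
bound in 138 068 + 95 784 exhaustive runs), so every margin `< 2^(b−1)/(2^p − 1)` fails for some
input; the statement with `≤` in the hypothesis is left open (not needed downstream).

USE.  This is the tool for the last case of "COMPRESS twice keeps the top component" (sequel of
`Expansions/CompressTopStableTools.lean`): after a REFLECTED emission `Qn = g + sgn(Q)·2^(b+1)`,
`q = Q − sgn(Q)·2^(b+1)` of the second traversal, re-compressing the emitted components
`q, rs…` must not climb back to distance `2^b` from `Qn`; `abs_add_lt_pow2_margin` below is the
bookkeeping that feeds the hypothesis of the theorem in that situation
(`|q| ≤ 2^b − μ`, `|Σ rs| ≤ μ/2 · (1 + ⋯ + ε^(n−1))`, `μ = ulp Q = 2^(b+1−p)`).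

HONEST FRAMING: new work of this programme checked in Lean — a modest property of a textbook
procedure, not a published result and no open problem; [Shewchuk1997, §2.7 Thm 23 p. 331–333]
and [BoldoEtAl2023, §2] supply only the objects.
-/

namespace Summit.Ventures.CertifiedArithmetic.Expansions

open Literature.ComputerArithmetic.JeannerodRump2018
open Literature.ComputerArithmetic.BoldoJeannerodMelquiondMuller2023 hiding twoSum twoSum_fst
open Literature.ComputerArithmetic.JoldesMullerPopescu2017 (ulp_le_of_abs_lt_two_zpow)
open Literature.ComputerArithmetic.GraillatMuller2025 (ulp_two_zpow)
open Literature.ComputerArithmetic.Shewchuk1997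

variable {p : ℕ} {emin : ℤ} {fl : ℚ → ℚ}

/-- THE MARGIN BOOKKEEPING of a reflected emission: `|q| ≤ 2^b − μ` and
`|σ| ≤ μ/2 · (1 + ε + ⋯ + ε^(n−1))` with `μ = 2^(b+1−p)` give `|q + σ| < 2^b − 2^(b−1)/(2^p − 1)`
(`p ≥ 2`). -/
theorem abs_add_lt_pow2_margin (hp : 2 ≤ p) {q σ : ℚ} {b : ℤ} {n : ℕ}
    (hq : |q| ≤ 2 ^ b - 2 ^ (b + 1 - p))
    (hσ : |σ| ≤ 2 ^ (b + 1 - p) / 2 * (Finset.range n).sum (fun i => ((2 : ℚ) ^ p)⁻¹ ^ i)) :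
    |q + σ| < 2 ^ b - 2 ^ (b - 1) / (2 ^ p - 1) := by
  have hp1 : 1 ≤ p := le_trans (by norm_num) hp
  have h2 : (2 : ℚ) ≠ 0 := by norm_num
  have hT : (1 : ℚ) < 2 ^ p := one_lt_pow₀ (by norm_num) (by omega)
  have hT1 : (0 : ℚ) < 2 ^ p - 1 := by linarith
  have hT4 : (4 : ℚ) ≤ 2 ^ p := by
    calc (4 : ℚ) = 2 ^ 2 := by norm_num
      _ ≤ 2 ^ p := pow_le_pow_right₀ (by norm_num) hp
  have hμpos : (0 : ℚ) < 2 ^ (b + 1 - p) := zpow_pos (by norm_num) _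
  have hgeo := geomFactor_lt (p := p) hp1 n
  have hσ' : |σ| < 2 ^ (b + 1 - p) / 2 * (2 ^ p / (2 ^ p - 1)) :=
    hσ.trans_lt (mul_lt_mul_of_pos_left hgeo (by linarith))
  -- `μ/2 · 2^p/(2^p − 1) = 2^b/(2^p − 1)` and `μ ≥ (2^b + 2^(b-1))/(2^p − 1)` (`p ≥ 2`)
  have e1 : (2 : ℚ) ^ (b + 1 - p) / 2 * (2 ^ p / (2 ^ p - 1)) = 2 ^ b / (2 ^ p - 1) := by
    rw [zpow_sub₀ h2, zpow_natCast, zpow_add_one₀ h2]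
    field_simp
  have e2 : (2 : ℚ) ^ b = 2 * 2 ^ (b - 1) := by rw [zpow_sub_one₀ h2]; ring
  have hμ : (2 ^ b + 2 ^ (b - 1)) / (2 ^ p - 1) ≤ (2 : ℚ) ^ (b + 1 - p) := by
    rw [div_le_iff₀ hT1]
    have e3 : (2 : ℚ) ^ (b + 1 - p) * 2 ^ p = 4 * 2 ^ (b - 1) := by
      rw [← zpow_natCast, ← zpow_add₀ h2, show b + 1 - (p : ℤ) + p = (b - 1) + 2 by ring,
        zpow_add₀ h2]
      norm_num; ring
    have hle : (2 : ℚ) ^ (b + 1 - p) ≤ 2 ^ (b - 1) := zpow_le_zpow_right₀ (by norm_num) (by omega)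
    rw [mul_sub, e3, mul_one, e2]
    linarith
  have hsplit : (2 ^ b + 2 ^ (b - 1)) / ((2 : ℚ) ^ p - 1) =
      2 ^ b / (2 ^ p - 1) + 2 ^ (b - 1) / (2 ^ p - 1) := by
    rw [add_div]
  calc |q + σ| ≤ |q| + |σ| := abs_add_le _ _
    _ < 2 ^ b - 2 ^ (b + 1 - p) + 2 ^ b / (2 ^ p - 1) := by rw [← e1]; linarith
    _ ≤ 2 ^ b - 2 ^ (b - 1) / (2 ^ p - 1) := by rw [hsplit] at hμ; linarith

/-- **COMPRESS NEVER OVERSHOOTS A POWER OF TWO** (`p ≥ 2`, ANY round-to-nearest, every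
nonoverlapping expansion `e` of floats): if `|Σ e| < 2^b − 2^(b-1)/(2^p − 1)` with
`b ≥ emin + p`, then the largest component `L` of `compress fl e` satisfies `|L| < 2^b`.
The margin `2^(b-1)/(2^p − 1) = 2^(b-p-1) · (1 + ε + ε² + ⋯)` is the supremum of the top error
just inside the power of two (`compress_top_error_pow2`); it is not attained, but for every `k`
the inputs `2^b − 2^(b-p-1)·(1 + ε + ⋯ + ε^(k-1))·(1 + η)` (small `η > 0` of the right shape)
are compressed onto `±2^b` by ties-away choices, so no smaller uniform margin works. -/
theorem abs_compress_top_lt_two_zpow (hp : 2 ≤ p) (hfl : IsRoundNearest p emin fl)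
    {e : List ℚ} (he : ∀ x ∈ e, IsFloat p emin x) (hexp : IsExpansion 1 e) {b : ℤ}
    (hb : emin + p ≤ b) (hsum : |e.sum| < 2 ^ b - 2 ^ (b - 1) / (2 ^ p - 1)) :
    ∀ L t, (compress fl e).reverse = L :: t → |L| < 2 ^ b := by
  intro L t hL
  have hp1 : 1 ≤ p := le_trans (by norm_num) hp
  have h2 : (2 : ℚ) ≠ 0 := by norm_num
  have hflc : RoundoffBelow 1 fl := roundoffBelow_one hp1 hfl
  have hT : (1 : ℚ) < 2 ^ p := one_lt_pow₀ (by norm_num) (by omega)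
  have hT1 : (0 : ℚ) < 2 ^ p - 1 := by linarith
  have hBpos : (0 : ℚ) < 2 ^ (b - 1) := zpow_pos (by norm_num) _
  have out := compress_spec hp hfl le_rfl hflc he hexp
  have hLmem : L ∈ compress fl e := by
    rw [← List.mem_reverse, hL]; exact List.mem_cons_self
  have hLF : IsFloat p emin L := out.floats L hLmem
  have hsplit : e.sum = L + t.sum := by
    rw [← out.sum_eq, ← List.sum_reverse, hL, List.sum_cons]
  -- the general bound `|Σ t| < ulp L`, from `compress_top_error`
  have herr := compress_top_error hp hfl he hexp L t hL
  have hgeo := geomFactor_lt (p := p) hp1 t.length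
  by_contra hge
  rw [not_lt] at hge
  rcases hge.lt_or_eq with hgt | heq
  · -- `|L| > 2^b`: then `|L| ≥ 2^b + 2^(b-p+1)` (the next float), while `|Σ t| < |L|/(2^p − 1)`
    have hTpos : (0 : ℚ) < 2 ^ p := by positivity
    have hTp4 : (4 : ℚ) ≤ 2 ^ p := by
      calc (4 : ℚ) = 2 ^ 2 := by norm_num
        _ ≤ 2 ^ p := pow_le_pow_right₀ (by norm_num) hp
    -- (1) `ulp L · 2^p ≤ 2 |L|`: `L` is normal
    have hUA : ulp p emin L * 2 ^ p ≤ 2 * |L| := by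
      obtain ⟨u, hu, hU⟩ := exists_ulp_eq_two_zpow (p := p) (emin := emin) L
      have hu1 : emin < u := by
        have h := two_zpow_le_ulp_of_le_abs (p := p) (emin := emin) b hge
        rw [hU] at h
        have := (zpow_le_zpow_iff_right₀ (by norm_num : (1 : ℚ) < 2)).mp h
        omega
      have hLnorm : (2 : ℚ) ^ (u + p - 1) ≤ |L| := two_zpow_le_abs_of_ulp_eq hU hu1
      have e : (2 : ℚ) ^ u * 2 ^ p = 2 ^ (u + p - 1) * 2 := by
        rw [← zpow_natCast, ← zpow_add₀ h2, zpow_sub_one₀ h2]; ring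
      rw [hU, e]; linarith
    -- (2) `|Σ t| · (2^p − 1) < ulp L · 2^p / 2 ≤ |L|`
    have hX : |t.sum| * (2 ^ p - 1) < |L| := by
      have h := herr.trans_lt (mul_lt_mul_of_pos_left hgeo
        (by linarith [ulp_pos (p := p) (emin := emin) L]))
      have e : ulp p emin L / 2 * (2 ^ p / (2 ^ p - 1)) * (2 ^ p - 1) =
          ulp p emin L * 2 ^ p / 2 := by
        field_simp
      calc |t.sum| * (2 ^ p - 1) < ulp p emin L / 2 * (2 ^ p / (2 ^ p - 1)) * (2 ^ p - 1) :=
            mul_lt_mul_of_pos_right h hT1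
        _ = ulp p emin L * 2 ^ p / 2 := e
        _ ≤ |L| := by linarith
    -- (3) the next float above `2^b` is `2^b + 2^(b-p+1)`
    have hfb : OnGrid (b - p + 1) ((2 : ℚ) ^ b) := OnGrid.two_zpow (by omega)
    have hulpL_ge : (2 : ℚ) ^ (b - p + 1) ≤ ulp p emin L := two_zpow_le_ulp_of_le_abs b hge
    have hgridL : OnGrid (b - p + 1) L := onGrid_of_two_zpow_le_ulp hLF hulpL_ge
    have hstep : (2 : ℚ) ^ b + 2 ^ (b - p + 1) ≤ |L| := hfb.add_two_zpow_le hgridL.abs hgt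
    have h2b : (2 : ℚ) ^ b = 2 * 2 ^ (b - 1) := by rw [zpow_sub_one₀ h2]; ring
    have h5 : (2 : ℚ) ^ b * 2 ^ p + 4 * 2 ^ (b - 1) ≤ |L| * 2 ^ p := by
      have e : (2 : ℚ) ^ (b - p + 1) * 2 ^ p = 4 * 2 ^ (b - 1) := by
        rw [← zpow_natCast, ← zpow_add₀ h2, show b - (p : ℤ) + 1 + p = (b - 1) + 2 by ring,
          zpow_add₀ h2]
        norm_num; ring
      have := mul_le_mul_of_nonneg_right hstep hTpos.le
      rwa [add_mul, e] at this
    -- (4) `|Σ e| ≥ |L| − |Σ t|`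
    have htri : |L| - |t.sum| ≤ |e.sum| := by
      rw [hsplit]
      have := abs_add_le (L + t.sum) (-t.sum)
      rw [abs_neg, add_neg_cancel_right] at this
      linarith
    have h4 : (|L| - |t.sum|) * (2 ^ p - 1) < 2 ^ b * (2 ^ p - 1) - 2 ^ (b - 1) := by
      have h := htri.trans_lt hsum
      have e : ((2 : ℚ) ^ b - 2 ^ (b - 1) / (2 ^ p - 1)) * (2 ^ p - 1) =
          2 ^ b * (2 ^ p - 1) - 2 ^ (b - 1) := by
        field_simp
      rw [← e]; exact mul_lt_mul_of_pos_right h hT1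
    -- the final arithmetic in `A = |L|`, `B₁ = 2^(b-1)`, `T = 2^p ≥ 4`
    have h6 : |L| * (2 ^ p - 2) < 2 ^ (b - 1) * (2 * 2 ^ p - 3) := by
      have h := add_lt_add h4 hX
      have e1 : (|L| - |t.sum|) * (2 ^ p - 1) + |t.sum| * (2 ^ p - 1) =
          |L| * (2 ^ p - 2) + |L| := by ring
      have e2 : (2 : ℚ) ^ b * (2 ^ p - 1) - 2 ^ (b - 1) + |L| =
          2 ^ (b - 1) * (2 * 2 ^ p - 3) + |L| := by rw [h2b]; ring
      rw [e1, e2] at h; linarith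
    have h7 : (2 * 2 ^ (b - 1) * 2 ^ p + 4 * 2 ^ (b - 1)) * ((2 : ℚ) ^ p - 2) ≤
        |L| * (2 ^ p - 2) * 2 ^ p := by
      have := mul_le_mul_of_nonneg_right h5 (by linarith : (0 : ℚ) ≤ 2 ^ p - 2)
      rw [h2b] at this
      calc _ ≤ |L| * 2 ^ p * (2 ^ p - 2) := this
        _ = _ := by ring
    have h8 : |L| * (2 ^ p - 2) * 2 ^ p < 2 ^ (b - 1) * (2 * 2 ^ p - 3) * 2 ^ p :=
      mul_lt_mul_of_pos_right h6 hTpos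
    have h9 : (2 * 2 ^ (b - 1) * 2 ^ p + 4 * 2 ^ (b - 1)) * ((2 : ℚ) ^ p - 2) -
        2 ^ (b - 1) * (2 * 2 ^ p - 3) * 2 ^ p = 2 ^ (b - 1) * (3 * 2 ^ p - 8) := by ring
    have h10 : (0 : ℚ) ≤ 2 ^ (b - 1) * (3 * 2 ^ p - 8) := mul_nonneg hBpos.le (by linarith)
    linarith [h7, h8, h9, h10]
  · -- `|L| = 2^b`
    have hLb : |L| = 2 ^ b := heq.symm
    rcases lt_or_ge (L * t.sum) 0 with hopp | hali
    · -- opposing: the sharp bound gives `|Σ t| < 2^(b-1)/(2^p - 1)`, so `|Σ e| > 2^b − margin`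
      have hsharp := compress_top_error_pow2 hp hfl he hexp L t hL b hLb hopp
      have hulpL : ulp p emin L = 2 ^ (b - p + 1) := by rw [← ulp_abs, hLb, ulp_two_zpow (by omega)]
      have hlt : |t.sum| < 2 ^ (b - 1) / (2 ^ p - 1) := by
        have h0 : (0 : ℚ) < ulp p emin L / 4 := by linarith [ulp_pos (p := p) (emin := emin) L]
        calc |t.sum|
            ≤ ulp p emin L / 4 * (Finset.range t.length).sum (fun i => ((2 : ℚ) ^ p)⁻¹ ^ i) :=
              hsharp
          _ < ulp p emin L / 4 * (2 ^ p / (2 ^ p - 1)) := mul_lt_mul_of_pos_left hgeo h0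
          _ = 2 ^ (b - 1) / (2 ^ p - 1) := by
              rw [hulpL, show b - p + 1 = (b - 1) + 2 - p by ring, zpow_sub₀ h2, zpow_natCast,
                zpow_add₀ h2]
              field_simp
              ring
      have htri : |L| - |t.sum| ≤ |e.sum| := by
        rw [hsplit]
        have := abs_add_le (L + t.sum) (-t.sum)
        rw [abs_neg, add_neg_cancel_right] at this
        linarith
      linarith
    · -- aligned (or `Σ t = 0`): `|Σ e| = |L| + |Σ t| ≥ 2^b`
      have hge' : |L| ≤ |e.sum| := by
        rw [hsplit]
        rcases le_or_gt 0 L with hL0 | hL0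
        · have ht0 : 0 ≤ t.sum := by
            by_contra hn; rw [not_le] at hn
            rcases hL0.lt_or_eq with hLp | hL00
            · exact absurd (mul_neg_of_pos_of_neg hLp hn) (not_lt.mpr hali)
            · rw [← hL00, abs_zero] at hLb; linarith [zpow_pos (by norm_num : (0:ℚ) < 2) b]
          rw [abs_of_nonneg hL0, abs_of_nonneg (by linarith)]; linarith
        · have ht0 : t.sum ≤ 0 := by
            by_contra hn; rw [not_le] at hn
            exact absurd (mul_neg_of_neg_of_pos hL0 hn) (not_lt.mpr hali)
          rw [abs_of_neg hL0, abs_of_nonpos (by linarith)]; linarith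
      linarith [div_pos hBpos hT1]

/-- `abs_compress_top_lt_two_zpow` in `getLast?` form: the LAST (largest) component of
`compress fl e` is below `2^b` in magnitude. -/
theorem abs_compress_getLast_lt_two_zpow (hp : 2 ≤ p) (hfl : IsRoundNearest p emin fl)
    {e : List ℚ} (he : ∀ x ∈ e, IsFloat p emin x) (hexp : IsExpansion 1 e) {b : ℤ}
    (hb : emin + p ≤ b) (hsum : |e.sum| < 2 ^ b - 2 ^ (b - 1) / (2 ^ p - 1)) :
    ∀ L, (compress fl e).getLast? = some L → |L| < 2 ^ b := by
  intro L hL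
  obtain ⟨t, ht⟩ := List.getLast?_eq_some_iff.mp hL
  exact abs_compress_top_lt_two_zpow hp hfl he hexp hb hsum L t.reverse (by simp [ht])

end Summit.Ventures.CertifiedArithmetic.Expansions
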